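import Summits.ResolutionOfSingularities.ResolutionOfSingularities.Theorems.HomologicalConductorNoZenoRHighDimDoor
import Summits.ResolutionOfSingularities.ResolutionOfSingularities.Theorems.HomologicalConductorStrictDropKernelIff
import HarnessLib

/-!
# Crux `StrictDrop` (stmt-ResolutionOfSingularities-16485) — the REGISTERED kernel `stub_dichotomy_dimGETwo` from the kill test
# `SurfaceTermination` (stmt-16488) and the residual (TOP′), both in the route's `let`-telescope (registrable texts)

Route `ResolutionOfSingularities/HomologicalConductor`.  OURS (cell decomp-res, hand leafhand-res-homologicalconduct-3); AI-written
bookkeeping over the landed doors (`HomologicalConductorNoZenoRHighDimDoor`, p801621), weaker than expert review; nothing here is a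
statement of any manuscript under review.  SUPPORT-level; no stub, crux, route or summit statement is proved here.

* `dichotomy_dimGETwo_of_surfaceTermination_of_topDim'` — the registered kernel text VERBATIM, from `SurfaceTermination` (the kill
  test's registered text) and **(TOP′) written in the route's `let`-telescope** (so that a planner can register it as the one
  residual stub): «for every admissible datum with `¬ dim A ≤ 2` all of whose stages keep the Krull dimension `dim A`, some stage is
  a regular local ring».  Proof: `HighDimDoor.strictDrop_of_surfaceTermination_of_topDim'` (crux from the two inputs) and hand-1's
  `KernelIff.dichotomy_dimGETwo_of_strictDrop` (kernel from the crux).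
* `strictDrop_of_surfaceTermination_of_topDimLet` — the crux BY NAME from the same two registrable texts.
-/

noncomputable section

-- single-problem summit: the doubled namespace component `ResolutionOfSingularities` is forced
set_option linter.dupNamespace false

open Summit.ResolutionOfSingularities.ResolutionOfSingularities.Theses.HomologicalConductor (StrictDrop SurfaceTermination)

namespace Summit.ResolutionOfSingularities.ResolutionOfSingularities.Theorems.StrictDrop.Birth.TopDim

/-- **Crux `StrictDrop` from the kill test and (TOP′), both as registrable `let`-telescope texts.** [folklore] -/
theorem strictDrop_of_surfaceTermination_of_topDimLet (hS : SurfaceTermination)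
    (hTop : ∀ p : ℕ, p.Prime → ∀ (k K : Type) [Field k] [CharP k p] [Field K] [Algebra k K] (O : ValuationSubring K) (A : Subalgebra k K), (∀ c : k, algebraMap k K c ∈ O) → A.FG → IsFractionRing ↥A K → A.toSubring ≤ O.toSubring → let ca : Subalgebra k K → Set K := fun A => {x : K | ∃ hx : x ∈ A, ∃ n : ℕ, ∀ i : ℕ, n ≤ i → ∀ (M N : ModuleCat.{0} ↥A), Module.Finite ↥A M → Module.Finite ↥A N → ∀ e : CategoryTheory.Abelian.Ext.{0} M N i, (⟨x, hx⟩ : ↥A) • e = 0}; let loc : Subalgebra k K → Subalgebra k K := fun A => Algebra.adjoin k {y : K | ∃ a ∈ A, ∃ s ∈ A, s⁻¹ ∈ O ∧ y = a * s⁻¹}; let chart : Subalgebra k K → Subalgebra k K := fun A => Algebra.adjoin k ((A : Set K) ∪ {y : K | ∃ c ∈ ca A, ∃ x ∈ ca A, x ≠ 0 ∧ (∀ c' ∈ ca A, c' * x⁻¹ ∈ O) ∧ y = c * x⁻¹}); let nrm : Subalgebra k K → Subalgebra k K := fun B => Algebra.adjoin k {y : K | IsIntegral ↥B y}; let tower :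 Subalgebra k K → ℕ → Subalgebra k K := fun A m => @Nat.rec (fun _ => Subalgebra k K) (loc A) (fun _ B => loc (nrm (chart B))) m; ¬ ringKrullDim ↥A ≤ 2 → (∀ n : ℕ, ringKrullDim ↥(tower A n) = ringKrullDim ↥A) → ∃ m : ℕ, IsRegularLocalRing ↥(tower A m)) :
    StrictDrop :=
  NoZeno.Birth.HighDimDoor.strictDrop_of_surfaceTermination_of_topDim' hS
    fun p hp k K _ _ _ _ O A hk hA hfr hAO hdim htop => hTop p hp k K O A hk hA hfr hAO hdim htop

/-- **The registered kernel `stub_dichotomy_dimGETwo` (text verbatim) from the kill test and (TOP′).** [folklore] -/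
theorem dichotomy_dimGETwo_of_surfaceTermination_of_topDim' (hS : SurfaceTermination)
    (hTop : ∀ p : ℕ, p.Prime → ∀ (k K : Type) [Field k] [CharP k p] [Field K] [Algebra k K] (O : ValuationSubring K) (A : Subalgebra k K), (∀ c : k, algebraMap k K c ∈ O) → A.FG → IsFractionRing ↥A K → A.toSubring ≤ O.toSubring → let ca : Subalgebra k K → Set K := fun A => {x : K | ∃ hx : x ∈ A, ∃ n : ℕ, ∀ i : ℕ, n ≤ i → ∀ (M N : ModuleCat.{0} ↥A), Module.Finite ↥A M → Module.Finite ↥A N → ∀ e : CategoryTheory.Abelian.Ext.{0} M N i, (⟨x, hx⟩ : ↥A) • e = 0}; let loc : Subalgebra k K → Subalgebra k K := fun A => Algebra.adjoin k {y : K | ∃ a ∈ A, ∃ s ∈ A, s⁻¹ ∈ O ∧ y = a * s⁻¹}; let chart : Subalgebra k K → Subalgebra k K := fun A => Algebra.adjoin k ((A : Set K) ∪ {y : K | ∃ c ∈ ca A, ∃ x ∈ ca A, x ≠ 0 ∧ (∀ c' ∈ ca A, c' * x⁻¹ ∈ O) ∧ y = c * x⁻¹}); let nrm : Subalgebra k K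 → Subalgebra k K := fun B => Algebra.adjoin k {y : K | IsIntegral ↥B y}; let tower : Subalgebra k K → ℕ → Subalgebra k K := fun A m => @Nat.rec (fun _ => Subalgebra k K) (loc A) (fun _ B => loc (nrm (chart B))) m; ¬ ringKrullDim ↥A ≤ 2 → (∀ n : ℕ, ringKrullDim ↥(tower A n) = ringKrullDim ↥A) → ∃ m : ℕ, IsRegularLocalRing ↥(tower A m)) :
    (∀ p : ℕ, p.Prime → ∀ (k K : Type) [Field k] [CharP k p] [Field K] [Algebra k K] (O : ValuationSubring K) (A : Subalgebra k K), (∀ c : k, algebraMap k K c ∈ O) → A.FG → IsFractionRing ↥A K → A.toSubring ≤ O.toSubring → let ca : Subalgebra k K → Set K := fun A => {x : K | ∃ hx : x ∈ A, ∃ n : ℕ, ∀ i : ℕ, n ≤ i → ∀ (M N : ModuleCat.{0} ↥A), Module.Finite ↥A M → Module.Finite ↥A N → ∀ e : CategoryTheory.Abelian.Ext.{0} M N i, (⟨x, hx⟩ : ↥A) • e = 0}; let loc : Subalgebra k K → Subalgebra k K := fun A => Algebra.adjoin k {y : K | ∃ a ∈ A, ∃ s ∈ A, s⁻¹ ∈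 O ∧ y = a * s⁻¹}; let chart : Subalgebra k K → Subalgebra k K := fun A => Algebra.adjoin k ((A : Set K) ∪ {y : K | ∃ c ∈ ca A, ∃ x ∈ ca A, x ≠ 0 ∧ (∀ c' ∈ ca A, c' * x⁻¹ ∈ O) ∧ y = c * x⁻¹}); let nrm : Subalgebra k K → Subalgebra k K := fun B => Algebra.adjoin k {y : K | IsIntegral ↥B y}; let tower : Subalgebra k K → ℕ → Subalgebra k K := fun A m => @Nat.rec (fun _ => Subalgebra k K) (loc A) (fun _ B => loc (nrm (chart B))) m; let Shape : Subalgebra k K → Prop := fun T => (∃ B : Subalgebra k K, B.FG ∧ B ≤ T ∧ loc B = T ∧ ∀ t ∈ T, ∃ b ∈ B, ∃ s ∈ B, s⁻¹ ∈ O ∧ t = b * s⁻¹) ∧ IsNoetherianRing ↥T ∧ T.toSubring ≤ O.toSubring ∧ ∀ s ∈ T, s⁻¹ ∈ O → s⁻¹ ∈ T; (∀ m : ℕ, Shape (tower A m)) → ∀ m : ℕ, (∀ n : ℕ, m ≤ n → ¬ IsRegularLocalRing ↥(tower A n)) → (∀ n : ℕ, m ≤ n → ¬ ringKrullDim ↥(tower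 A n) ≤ 1) → (∃ m' : ℕ, m < m' ∧ ∃ y ∈ ca (tower A m'), y ≠ 0 ∧ ∀ x ∈ ca (tower A m), x ≠ 0 → y * x⁻¹ ∉ O) ∨ ∃ n : ℕ, m ≤ n ∧ tower A (n + 1) = tower A n) :=
  KernelIff.dichotomy_dimGETwo_of_strictDrop (strictDrop_of_surfaceTermination_of_topDimLet hS hTop)

end Summit.ResolutionOfSingularities.ResolutionOfSingularities.Theorems.StrictDrop.Birth.TopDim

end
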